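import Summits.ABC.StewartYu.PadicG3SatLevels
import Summits.ABC.StewartYu.PadicG3Output
import Summits.ABC.StewartYu.GenThreeFrameSpecOddRat
import Summits.ABC.StewartYu.GenThreeEndBridgeReal
import HarnessLib

/-!
# Cell abc-stewartyu, WP-L.P(odd) (crux r3 `PadicCoreOddRat`, stmt-ABC-20503): the OUTPUT of the saturated frame — the last-level identities
# in `θ^{μx}` with `b̃`-directions are identities at the REAL ROOT POINT `(x, ξˣ)`, `ξ = αo^{1/N}`, with `bo`-directions

`Summits/ABC/StewartYu/PadicG3SatOutput.lean` — cell `abc-stewartyu` (HOME `run/shared/lean/pub/abc-stewartyu/`, design memo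
HOME/p2/memo-07-WPLP-odd-Nframe-design.md §1 (L4), §2 row «output/END»; seat p2-g6).  Theorems only; no named fact, no parameters.

* `bDir_eq_sum_mul_zγ` — the direction change: `bo_{j₀}·ν(v)ⱼ − boⱼ·ν(v)_{j₀} = Σₖ (bo_{j₀}Uₖⱼ − boⱼU_{k j₀})·zγ(v)ₖ` (because `b ᵥ* U = N·bo`);
* **`LvInvSatI.frameOutputSat`** — the last-level saturated invariant (`Rl = feldR`, nodes `|x| ≤ N`, order `T`, `2(n+1)X′ ≤ N`,
  `(n+1)S₀ < T`) gives `FrameOutputReal n ξ bo j₀ D₀ S₀ X′ (2·Bv)` at `ξ = rootUnitsN N αo` for ANY index `j₀` (the frame uses a pivot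
  `bo j₀ ≠ 0`): vanishing at the even points `2x′`, `MomentGL` (`GenThreeEndBridgeReal`) from the `b̃`-moments to the `bo`-moments of the
  virtual exponents, the dictionary `GenThreeFrameSpecOddRat.ratCast_eq_prod_rootUnitsN_zpow` (`θ^{μ·2x′} = ξ^{x′·2ν(μ)}`), and the Units
  bridge `frameOutputReal_of_hasseIdentities` with exponents `2·ν(vᵢ)`, polynomials `feldR ∘ (2Y₀)`.

WHAT THIS IS NOT: no record, no END call (that is `GenThreeFrameSpecOddRat.dichotomyOddRatPos_of_frame`); no crux moves.

References: Yu. V. Nesterenko, LNM 1819 (2003) §5.1 (5.3)–(5.4); K. Yu, Acta Math. 211 (2013) §6.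
-/

noncomputable section

open NormedSpace Finset Polynomial
open scoped Matrix
open Literature.NumberTheory.Transcendental
open Literature.NumberTheory.Transcendental.CW77.Setup (Tau tauNorm)
open Summit.ABC.StewartYu.FeldmanBasis (feldR exists_fibre_ne_zero natDegree_feldR_le)
open Summit.ABC.StewartYu.GenThreeFrameSpecTwoRat (FrameOutputReal)
open Summit.ABC.StewartYu.GenThreeFrameSpecOddRat (rootUnitsN ratCast_eq_prod_rootUnitsN_zpow)
open scoped Nat

namespace Summit.ABC.StewartYu

/-! ### The output of the saturated frame -/

namespace G3Setup

variable {p : ℕ} [Fact p.Prime] {S : G3Setup p}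

/-- **The direction change**: for `g j k := bo j₀ * U k j − bo j * U k j₀`,
`bo_{j₀}·ν(v)ⱼ − boⱼ·ν(v)_{j₀} = Σₖ gⱼₖ · zγ(v)ₖ` (because `Σₖ gⱼₖ b̃ₖ = 0` from `b̃ ᵥ* U = N·bo`). [folklore] -/
theorem bDir_eq_sum_mul_zγ (F : S.SatData) (j₀ : Fin S.n) (v : Fin S.n → ℤ) (j : Fin S.n) :
    ((F.bo j₀ * (v ᵥ* F.U) j - F.bo j * (v ᵥ* F.U) j₀ : ℤ) : ℚ) =
      ∑ k, ((F.bo j₀ * F.U k j - F.bo j * F.U k j₀ : ℤ) : ℚ) * S.zγ v k := by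
  have hb0 : (S.b S.j₀ : ℚ) ≠ 0 := by exact_mod_cast S.bj₀_ne
  -- `Σₖ gⱼₖ b̃ₖ = 0`
  have hU := F.b_vecMul_U
  have e1 : ∀ j', (∑ k, (S.b k : ℚ) * (F.U k j' : ℚ)) = (F.N : ℚ) * (F.bo j' : ℚ) := by
    intro j'
    have h := congrFun hU j'
    simp only [Matrix.vecMul, dotProduct, Pi.smul_apply, smul_eq_mul] at h
    have h' := congrArg (fun z : ℤ => (z : ℚ)) h
    push_cast at h'
    exact h'
  have hsum0 : ∑ k, ((F.bo j₀ * F.U k j - F.bo j * F.U k j₀ : ℤ) : ℚ) * (S.b k : ℚ) = 0 := by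
    calc ∑ k, ((F.bo j₀ * F.U k j - F.bo j * F.U k j₀ : ℤ) : ℚ) * (S.b k : ℚ)
        = (F.bo j₀ : ℚ) * ∑ k, (S.b k : ℚ) * (F.U k j : ℚ) - (F.bo j : ℚ) * ∑ k, (S.b k : ℚ) * (F.U k j₀ : ℚ) := by
          rw [mul_sum, mul_sum, ← sum_sub_distrib]
          refine sum_congr rfl fun k _ => ?_
          push_cast; ring
      _ = 0 := by rw [e1 j, e1 j₀]; ring
  -- clear the denominator `b̃_{j₀}`
  have hz : ∀ k, S.zγ v k * (S.b S.j₀ : ℚ) = ((S.b S.j₀ * v k - S.b k * v S.j₀ : ℤ) : ℚ) := by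
    intro k; unfold zγ 𝔛; rw [div_mul_cancel₀ _ hb0]
  refine mul_right_cancel₀ hb0 ?_
  have hR : (∑ k, ((F.bo j₀ * F.U k j - F.bo j * F.U k j₀ : ℤ) : ℚ) * S.zγ v k) * (S.b S.j₀ : ℚ) =
      (S.b S.j₀ : ℚ) * ∑ k, ((F.bo j₀ * F.U k j - F.bo j * F.U k j₀ : ℤ) : ℚ) * (v k : ℚ) := by
    rw [sum_mul]
    have h1 : ∑ k, ((F.bo j₀ * F.U k j - F.bo j * F.U k j₀ : ℤ) : ℚ) * S.zγ v k * (S.b S.j₀ : ℚ) =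
        ∑ k, ((F.bo j₀ * F.U k j - F.bo j * F.U k j₀ : ℤ) : ℚ) * (((S.b S.j₀ * v k - S.b k * v S.j₀ : ℤ)) : ℚ) :=
      sum_congr rfl fun k _ => by rw [mul_assoc, hz k]
    have h2 : ∑ k, ((F.bo j₀ * F.U k j - F.bo j * F.U k j₀ : ℤ) : ℚ) * (((S.b S.j₀ * v k - S.b k * v S.j₀ : ℤ)) : ℚ) =
        (S.b S.j₀ : ℚ) * ∑ k, ((F.bo j₀ * F.U k j - F.bo j * F.U k j₀ : ℤ) : ℚ) * (v k : ℚ) -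
          (v S.j₀ : ℚ) * ∑ k, ((F.bo j₀ * F.U k j - F.bo j * F.U k j₀ : ℤ) : ℚ) * (S.b k : ℚ) := by
      rw [mul_sum, mul_sum, ← sum_sub_distrib]
      refine sum_congr rfl fun k _ => ?_
      push_cast; ring
    rw [h1, h2, hsum0, mul_zero, sub_zero]
  rw [hR]
  have h3 : ∀ j', ((v ᵥ* F.U) j' : ℚ) = ∑ k, (v k : ℚ) * (F.U k j' : ℚ) := by
    intro j'; simp only [Matrix.vecMul, dotProduct]; push_cast; rfl
  have h4 : ∑ k, ((F.bo j₀ * F.U k j - F.bo j * F.U k j₀ : ℤ) : ℚ) * (v k : ℚ) =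
      (F.bo j₀ : ℚ) * ∑ k, (v k : ℚ) * (F.U k j : ℚ) - (F.bo j : ℚ) * ∑ k, (v k : ℚ) * (F.U k j₀ : ℚ) := by
    rw [mul_sum, mul_sum, ← sum_sub_distrib]
    refine sum_congr rfl fun k _ => ?_
    push_cast; ring
  rw [h4]
  push_cast
  rw [h3 j, h3 j₀]
  ring

namespace LvInvSatI

variable {F : S.SatData} {K : Type*} [DecidableEq K] {B : Finset (ℕ × K)} {v : ℕ × K → Fin S.n → ℤ} {sgn pv : ℕ × K → ℤ}
  {lo : Fin S.n → ℤ} {L : Fin S.n → ℕ} {vlo : Fin S.n → ℤ} {Bv : Fin S.n → ℕ} {P : ℤ} {m N T H : ℕ}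

/-- **THE FRAME OUTPUT OF THE SATURATED FRAME from the last level**, at the real root point `ξ = αo^{1/N}` with `bo`-directions for any index
`j₀`: exponents `2·ν(vᵢ)` (box `2·Bv`), polynomials `feldR ∘ (2Y₀)`. [cite: Nesterenko2003, §5.1 (5.3)–(5.4)] [cite: Yu2013, §6] -/
theorem frameOutputSat (h : S.LvInvSatI F (fun i => feldR i.1 H) B v sgn pv lo L vlo Bv P m {x : ℤ | |x| ≤ (N : ℤ)} T)
    {D₀ : ℕ} (hdeg : ∀ i ∈ B, i.1 ≤ D₀) (hv : ∀ i ∈ B, ∀ i' ∈ B, v i = v i' ↔ i.2 = i'.2)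
    {X' S₀ : ℕ} (hX : 2 * ((S.n + 1) * X') ≤ N) (hS : (S.n + 1) * S₀ < T) (j₀ : Fin S.n) :
    FrameOutputReal S.n (rootUnitsN F.N F.αo F.hαo) F.bo j₀ D₀ S₀ X' (fun j => 2 * Bv j) := by
  classical
  have hI := h.toI
  obtain ⟨i₀, hi₀B, hi₀⟩ := hI.nonzero
  -- injectivity of `ν`
  have hνinj : ∀ w w' : Fin S.n → ℤ, w ᵥ* F.U = w' ᵥ* F.U → w = w' := by
    intro w w' hww
    have h1 := F.vecMul_U_vecMul_C w
    have h2 := F.vecMul_U_vecMul_C w'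
    rw [hww] at h1
    rw [h1] at h2
    funext j
    have hj := congrFun h2 j
    simp only [Pi.smul_apply, smul_eq_mul] at hj
    have hN0 : (F.N : ℤ) ≠ 0 := by exact_mod_cast F.hN.ne'
    exact mul_left_cancel₀ hN0 hj
  refine GenThreeEndBridgeReal.frameOutputReal_of_hasseIdentities B (fun i => (feldR i.1 H).comp (C (2 : ℚ) * X))
    (fun i => (2 : ℤ) • (v i ᵥ* F.U)) (fun i => (pv i : ℚ)) _ F.bo j₀ D₀ S₀ X' (fun j => 2 * Bv j) ?_ ?_ ?_ ?_
  · -- degrees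
    intro i hi
    rw [natDegree_comp, natDegree_C_mul two_ne_zero, natDegree_X, mul_one]
    exact (natDegree_feldR_le _ _).trans (hdeg i hi)
  · -- box
    intro i hi j
    have := h.vabs_le i hi j
    simp only [Pi.smul_apply, smul_eq_mul, abs_mul, Nat.cast_mul, Nat.cast_ofNat]
    rw [show |(2 : ℤ)| = 2 by norm_num]
    exact mul_le_mul_of_nonneg_left this (by norm_num)
  · -- a non-zero exponent fibre
    obtain ⟨κ₀, hne⟩ := exists_fibre_ne_zero H B pv hi₀B hi₀
    have hnonempty : (B.filter (fun i => i.2 = κ₀)).Nonempty := by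
      by_contra h0
      rw [Finset.not_nonempty_iff_eq_empty] at h0
      rw [h0, sum_empty] at hne
      exact hne rfl
    obtain ⟨i₁, hi₁⟩ := hnonempty
    have hi₁B : i₁ ∈ B := (mem_filter.mp hi₁).1
    have hi₁κ : i₁.2 = κ₀ := (mem_filter.mp hi₁).2
    refine ⟨(2 : ℤ) • (v i₁ ᵥ* F.U), ?_⟩
    have hfib : B.filter (fun i => (2 : ℤ) • (v i ᵥ* F.U) = (2 : ℤ) • (v i₁ ᵥ* F.U)) = B.filter (fun i => i.2 = κ₀) := by
      refine filter_congr fun i hi => ?_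
      rw [← hi₁κ, ← hv i hi i₁ hi₁B]
      constructor
      · intro h2
        apply hνinj
        funext j; have := congrFun h2 j; simp only [Pi.smul_apply, smul_eq_mul] at this; omega
      · intro h2; rw [h2]
    rw [hfib]
    intro h0
    apply hne
    apply Polynomial.funext
    intro z
    have hz := congrArg (fun f : ℚ[X] => f.eval (z / 2)) h0
    simp only [eval_finsetSum, eval_smul, eval_comp, eval_mul, eval_C, eval_X, eval_zero] at hz
    rw [show (2 : ℚ) * (z / 2) = z by ring] at hz
    simp only [eval_finsetSum, eval_smul, eval_zero]
    exact hz
  · -- the identities at the root point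
    intro x' hx' t ν _hν hsum
    have hx : |2 * x'| ≤ (N : ℤ) := by
      rw [abs_mul, show |(2 : ℤ)| = 2 by norm_num]
      have : |x'| ≤ (((S.n + 1) * X' : ℕ) : ℤ) := hx'
      push_cast at this ⊢
      nlinarith [abs_nonneg x']
    -- (a) the moments in the `b̃`-basis vanish, for all orders `|ν'| ≤ T − 1 − t`
    set W : ℕ × K → ℚ := fun i => (pv i : ℚ) * (hasseDeriv t (feldR i.1 H)).eval (((2 * x' : ℤ)) : ℚ) *
      ∏ j, S.α j ^ (v i j * (2 * x')) with hW
    have hmomX : ∀ ν' : Fin S.n → ℕ, ∑ k, ν' k ≤ T - 1 - t → ∑ i ∈ B, W i * ∏ k, S.zγ (v i) k ^ ν' k = 0 := by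
      intro ν' hν'
      have hτ : tauNorm ((t, ν') : Tau S.n) < T := by
        unfold tauNorm; simp only; omega
      have hvan := hI.vanish (2 * x') hx (t, ν') hτ
      rw [LvInvI.pvx_two_mul] at hvan
      unfold g3φ at hvan
      rw [← hvan]
      refine sum_congr rfl fun i _ => ?_
      simp only [hW, zγpow]
      ring
    -- (b) `MomentGL`: the moments in the `bo`-basis vanish
    have hmomY := DirWeights.sum_mul_prod_pow_eq_zero_of_linear B W (fun i k => S.zγ (v i) k)
      (fun i j => ((F.bo j₀ * (v i ᵥ* F.U) j - F.bo j * (v i ᵥ* F.U) j₀ : ℤ) : ℚ))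
      (fun j k => ((F.bo j₀ * F.U k j - F.bo j * F.U k j₀ : ℤ) : ℚ))
      (fun i _ j => bDir_eq_sum_mul_zγ F j₀ (v i) j) (T - 1 - t) hmomX ν (by omega)
    -- (c) cast to `ℂ` and convert each factor
    have hmono : ∀ i ∈ B, (((∏ j, S.α j ^ (v i j * (2 * x')) : ℚ)) : ℂ) =
        ∏ j, ((rootUnitsN F.N F.αo F.hαo j : ℂˣ) : ℂ) ^ (x' * ((2 : ℤ) • (v i ᵥ* F.U)) j) := by
      intro i _
      have hpow := SatCoords.prod_zpow_pow_eq F.αo S.α F.U F.N F.αo_ne F.hU (fun j => v i j * (2 * x'))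
      have hexp : ∀ j, ((fun j => v i j * (2 * x')) ᵥ* F.U) j = x' * ((2 : ℤ) • (v i ᵥ* F.U)) j := by
        intro j
        have : (fun j => v i j * (2 * x')) = (2 * x') • v i := by funext j'; simp [mul_comm]
        rw [this, Matrix.smul_vecMul]
        simp only [Pi.smul_apply, smul_eq_mul]; ring
      refine ratCast_eq_prod_rootUnitsN_zpow F.N F.hN F.αo F.hαo _ (SatCoords.prod_zpow_pos S.α F.hθ _) _ ?_
      rw [hpow]
      exact prod_congr rfl fun j _ => by rw [hexp j]
    have hterm : ∀ i ∈ B, ((pv i : ℚ) : ℂ) * (((hasseDeriv t ((feldR i.1 H).comp (C (2 : ℚ) * X))).eval (x' : ℚ) : ℚ) : ℂ) *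
        (∏ k, (((F.bo j₀ * ((2 : ℤ) • (v i ᵥ* F.U)) k - F.bo k * ((2 : ℤ) • (v i ᵥ* F.U)) j₀ : ℤ)) : ℂ) ^ ν k) *
        ∏ j, ((rootUnitsN F.N F.αo F.hαo j : ℂˣ) : ℂ) ^ (x' * ((2 : ℤ) • (v i ᵥ* F.U)) j) =
        ((2 : ℂ) ^ t * (2 : ℂ) ^ (∑ k, ν k)) *
          (((W i * ∏ j, ((F.bo j₀ * (v i ᵥ* F.U) j - F.bo j * (v i ᵥ* F.U) j₀ : ℤ) : ℚ) ^ ν j : ℚ)) : ℂ) := by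
      intro i hi
      rw [← hmono i hi, G3Output.hasseDeriv_comp_C_mul_X_eval]
      have hdir : ∀ k, (((F.bo j₀ * ((2 : ℤ) • (v i ᵥ* F.U)) k - F.bo k * ((2 : ℤ) • (v i ᵥ* F.U)) j₀ : ℤ)) : ℂ) =
          2 * (((F.bo j₀ * (v i ᵥ* F.U) k - F.bo k * (v i ᵥ* F.U) j₀ : ℤ) : ℚ) : ℂ) := by
        intro k; simp only [Pi.smul_apply, smul_eq_mul]; push_cast; ring
      simp_rw [hdir, mul_pow]
      rw [prod_mul_distrib, prod_pow_eq_pow_sum]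
      simp only [hW]
      push_cast
      ring
    rw [sum_congr rfl hterm, ← mul_sum, ← Rat.cast_sum, hmomY, Rat.cast_zero, mul_zero]

end LvInvSatI

end G3Setup

end Summit.ABC.StewartYu

end
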